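import Mathlib.Analysis.SpecialFunctions.Log.Base
import Mathlib.Analysis.SpecialFunctions.Pow.Continuity
import Mathlib.Analysis.Complex.Basic
import Mathlib.Topology.Algebra.Order.Floor
import HarnessLib

/-!
# Geometric chains of planar arcs accumulating at a point

Topic: Topology / PlaneTopology. A standard device for building Jordan arcs with prescribed
behaviour at all small scales near one point (curves of positive area near a point after
W. F. Osgood, boundaries oscillating at every scale, …): from ONE parametrised piece
`G : [0, 1] → ℂ` with `G 0 = 2 • G 1` one forms the chain of its dyadic copies `2⁻ⁿ • G [0, 1]`,
`n ∈ ℤ` — consecutive copies share the point `2⁻ⁿ • G 1 = 2⁻⁽ⁿ⁺¹⁾ • G 0` — and parametrises it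
by `t = 2^{-(n + θ)} ↦ 2⁻ⁿ • G θ`; the value `0` at `t = 0` makes it a continuous map
`geomChain G : ℝ → ℂ` with `geomChain G 1 = G 0` and `geomChain G (2⁻ⁿ) = 2⁻ⁿ • G 0 → 0`.

* `chainPhase t = fract (-log₂ t)` and `geomChain G t = (t · 2^{θ(t)}) • G (θ(t))` (closed
  form without case split: the scalar is `2^{-⌊-log₂ t⌋}` for `t > 0`, and `0` at `t = 0`);
* `geomChain_zero`, `geomChain_one`, `geomChain_rpow` (the value at `2^{-(n+θ)}`),
  `geomChain_inv_pow` (the junction points `2⁻ⁿ ↦ 2⁻ⁿ • G 0`), `exists_eq_smul_of_pos` (every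
  value at `0 < t ≤ 1` is `c • G θ` with `0 < c ≤ 1`, `c ≤ 2t`, `θ ∈ [0, 1)`),
  `image_geomChain_Icc`, `image_geomChain_Icc_nat` (the image of `[2⁻ⁿ⁻¹, 2⁻ⁿ]` is the copy
  `2⁻ⁿ • G [0, 1]`);
* `continuous_geomChain` — continuity (away from `0` through the continuous `1`-periodic
  function `(θ ↦ 2^θ • G θ) ∘ fract`, Mathlib's `ContinuousOn.comp_fract''`; at `0` from
  `‖geomChain G t‖ ≤ ‖t‖ · sup ‖2^θ • G θ‖`);
* `injOn_geomChain` — injectivity on `[0, ∞)` when `G` is injective on `[0, 1)` with real parts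
  in the half-open strip `(re G 0 / 2, re G 0]`, `0 < re G 0` (the copies then have real parts
  in the pairwise disjoint strips `(2⁻ⁿ⁻¹ re G 0, 2⁻ⁿ re G 0]`).

All statements are [folklore] (self-similar chains of arcs; cf. W. F. Osgood, *A Jordan curve
of positive area*, Trans. Amer. Math. Soc. 4 (1903), 107–112). Mathlib: `Int.fract`,
`Int.floor`, `Real.logb`, `Real.rpow`, `ContinuousOn.comp_fract''`; Mathlib has no chains of
arcs. Deliberately NOT here: any statement about the topology of the plane (Jordan curves
through such chains are assembled by the users, e.g. with `quadLoop` of `AnnulusFaces.lean`).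
-/

noncomputable section

open Set Filter Function
open _root_.Topology
open scoped Pointwise

namespace Literature.Topology.PlaneTopology

variable {G : ℝ → ℂ}

/-- The **phase** `θ(t) = fract (-log₂ t) ∈ [0, 1)` of the parameter `t` of a geometric chain
(`t = 2^{-(n + θ(t))}` with `n = ⌊-log₂ t⌋`). [folklore] -/
def chainPhase (t : ℝ) : ℝ := Int.fract (-Real.logb 2 t)

/-- The phase lies in `[0, 1)`. [folklore] -/
theorem chainPhase_mem (t : ℝ) : chainPhase t ∈ Ico (0 : ℝ) 1 :=
  ⟨Int.fract_nonneg _, Int.fract_lt_one _⟩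

/-- **The geometric chain** of the dyadic copies of the piece `G : [0, 1] → ℂ`:
`2^{-(n + θ)} ↦ 2⁻ⁿ • G θ` (`n ∈ ℤ`, `θ ∈ [0, 1)`) and `0 ↦ 0`, in the closed form
`t ↦ (t · 2^{θ(t)}) • G (θ(t))`. [folklore] -/
def geomChain (G : ℝ → ℂ) (t : ℝ) : ℂ := (t * (2 : ℝ) ^ chainPhase t) • G (chainPhase t)

/-- The chain starts at the accumulation point `0`. [folklore] -/
@[simp] theorem geomChain_zero : geomChain G 0 = 0 := by simp [geomChain]

/-- For `t > 0` the scalar of the chain is `2^{-⌊-log₂ t⌋}`. [folklore] -/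
theorem mul_rpow_chainPhase {t : ℝ} (ht : 0 < t) :
    t * (2 : ℝ) ^ chainPhase t = (2 : ℝ) ^ (-(⌊-Real.logb 2 t⌋ : ℝ)) := by
  have h2 : (0 : ℝ) < 2 := two_pos
  calc t * (2 : ℝ) ^ chainPhase t = (2 : ℝ) ^ Real.logb 2 t * (2 : ℝ) ^ chainPhase t := by
        rw [Real.rpow_logb h2 (by norm_num) ht]
    _ = (2 : ℝ) ^ (Real.logb 2 t + chainPhase t) := (Real.rpow_add h2 _ _).symm
    _ = (2 : ℝ) ^ (-(⌊-Real.logb 2 t⌋ : ℝ)) := by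
        congr 1
        rw [chainPhase, ← Int.self_sub_floor]
        ring

/-- The value of the chain at `t > 0`: `2^{-⌊-log₂ t⌋} • G (fract (-log₂ t))`. [folklore] -/
theorem geomChain_of_pos {t : ℝ} (ht : 0 < t) :
    geomChain G t = ((2 : ℝ) ^ (-(⌊-Real.logb 2 t⌋ : ℝ))) • G (Int.fract (-Real.logb 2 t)) := by
  rw [geomChain, mul_rpow_chainPhase ht]
  rfl

/-- The value at `t = 2^{-(n + θ)}`, `θ ∈ [0, 1)`: the point `2⁻ⁿ • G θ` of the `n`-th copy.
[folklore] -/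
theorem geomChain_rpow_of_mem_Ico (n : ℤ) {θ : ℝ} (hθ : θ ∈ Ico (0 : ℝ) 1) :
    geomChain G ((2 : ℝ) ^ (-((n : ℝ) + θ))) = ((2 : ℝ) ^ (-(n : ℝ))) • G θ := by
  have h2 : (0 : ℝ) < 2 := two_pos
  have ht : 0 < (2 : ℝ) ^ (-((n : ℝ) + θ)) := Real.rpow_pos_of_pos h2 _
  have hlog : -Real.logb 2 ((2 : ℝ) ^ (-((n : ℝ) + θ))) = n + θ := by
    rw [Real.logb_rpow h2 (by norm_num)]
    ring
  have hfl : ⌊(n : ℝ) + θ⌋ = n := by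
    rw [Int.floor_intCast_add, Int.floor_eq_zero_iff.2 hθ, add_zero]
  have hfr : Int.fract ((n : ℝ) + θ) = θ := by
    rw [Int.fract_intCast_add, Int.fract_eq_self.2 ⟨hθ.1, hθ.2⟩]
  rw [geomChain_of_pos ht, hlog, hfl, hfr]

/-- **The value at `t = 2^{-(n + θ)}`, `θ ∈ [0, 1]`**, is `2⁻ⁿ • G θ`, provided consecutive
copies match up (`G 0 = 2 • G 1`). [folklore] -/
theorem geomChain_rpow (hj : G 0 = (2 : ℝ) • G 1) (n : ℤ) {θ : ℝ} (hθ : θ ∈ Icc (0 : ℝ) 1) :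
    geomChain G ((2 : ℝ) ^ (-((n : ℝ) + θ))) = ((2 : ℝ) ^ (-(n : ℝ))) • G θ := by
  rcases hθ.2.lt_or_eq with h | h
  · exact geomChain_rpow_of_mem_Ico n ⟨hθ.1, h⟩
  · subst h
    have key := geomChain_rpow_of_mem_Ico (G := G) (n + 1) (θ := 0) ⟨le_rfl, one_pos⟩
    rw [add_zero, Int.cast_add, Int.cast_one] at key
    rw [key, hj, smul_smul]
    congr 1
    rw [show (-(n : ℝ)) = -((n : ℝ) + 1) + 1 by ring, Real.rpow_add two_pos, Real.rpow_one]

/-- The chain ends at `geomChain G 1 = G 0`. [folklore] -/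
@[simp] theorem geomChain_one : geomChain G 1 = G 0 := by
  simp [geomChain, chainPhase]

/-- The junction points: `geomChain G (2⁻ⁿ) = 2⁻ⁿ • G 0`. [folklore] -/
theorem geomChain_inv_pow (n : ℕ) : geomChain G (((2 : ℝ) ^ n)⁻¹) = ((2 : ℝ) ^ n)⁻¹ • G 0 := by
  have key := geomChain_rpow_of_mem_Ico (G := G) n (θ := 0) ⟨le_rfl, one_pos⟩
  rw [add_zero, Int.cast_natCast, Real.rpow_neg two_pos.le, Real.rpow_natCast] at key
  exact key

/-- **Every value of the chain at `0 < t ≤ 1` is a point `c • G θ`** of a copy of the piece,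
with `0 < c ≤ 1`, `c ≤ 2t` and `θ ∈ [0, 1)`. [folklore] -/
theorem exists_eq_smul_of_pos {t : ℝ} (ht : 0 < t) (ht1 : t ≤ 1) :
    ∃ c : ℝ, 0 < c ∧ c ≤ 1 ∧ c ≤ 2 * t ∧ ∃ θ ∈ Ico (0 : ℝ) 1, geomChain G t = c • G θ := by
  refine ⟨t * (2 : ℝ) ^ chainPhase t, by positivity, ?_, ?_, chainPhase t, chainPhase_mem t, rfl⟩
  · rw [mul_rpow_chainPhase ht]
    have hu : 0 ≤ -Real.logb 2 t := by
      have := Real.logb_nonpos one_lt_two ht.le ht1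
      linarith
    have hfl : (0 : ℝ) ≤ ⌊-Real.logb 2 t⌋ := by exact_mod_cast Int.floor_nonneg.2 hu
    calc (2 : ℝ) ^ (-(⌊-Real.logb 2 t⌋ : ℝ)) ≤ (2 : ℝ) ^ (0 : ℝ) :=
          Real.rpow_le_rpow_of_exponent_le one_le_two (by linarith)
      _ = 1 := Real.rpow_zero _
  · have h1 : (2 : ℝ) ^ chainPhase t ≤ 2 := by
      calc (2 : ℝ) ^ chainPhase t ≤ (2 : ℝ) ^ (1 : ℝ) :=
            Real.rpow_le_rpow_of_exponent_le one_le_two (chainPhase_mem t).2.le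
        _ = 2 := Real.rpow_one _
    nlinarith

/-- **The image of the parameter interval `[2^{-(n+1)}, 2⁻ⁿ]` is the `n`-th copy
`2⁻ⁿ • G [0, 1]`.** [folklore] -/
theorem image_geomChain_Icc (hj : G 0 = (2 : ℝ) • G 1) (n : ℤ) :
    geomChain G '' Icc ((2 : ℝ) ^ (-((n : ℝ) + 1))) ((2 : ℝ) ^ (-(n : ℝ))) =
      ((2 : ℝ) ^ (-(n : ℝ))) • (G '' Icc 0 1) := by
  have h2 : (0 : ℝ) < 2 := two_pos
  ext z
  constructor
  · rintro ⟨t, ht, rfl⟩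
    have htpos : 0 < t := lt_of_lt_of_le (Real.rpow_pos_of_pos h2 _) ht.1
    obtain ⟨θ, hθ⟩ : ∃ θ : ℝ, θ = -Real.logb 2 t - n := ⟨_, rfl⟩
    have hθmem : θ ∈ Icc (0 : ℝ) 1 := by
      rw [hθ]
      constructor
      · have : Real.logb 2 t ≤ -(n : ℝ) := (Real.logb_le_iff_le_rpow one_lt_two htpos).2 ht.2
        linarith
      · have : -((n : ℝ) + 1) ≤ Real.logb 2 t :=
          (Real.le_logb_iff_rpow_le one_lt_two htpos).2 ht.1
        linarith
    have hteq : t = (2 : ℝ) ^ (-((n : ℝ) + θ)) := by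
      rw [hθ, show -((n : ℝ) + (-Real.logb 2 t - n)) = Real.logb 2 t by ring,
        Real.rpow_logb h2 (by norm_num) htpos]
    have key : geomChain G t = ((2 : ℝ) ^ (-(n : ℝ))) • G θ := by
      rw [hteq, geomChain_rpow hj n hθmem]
    rw [key]
    exact smul_mem_smul_set ⟨θ, hθmem, rfl⟩
  · intro hz
    obtain ⟨y, ⟨θ, hθ, rfl⟩, rfl⟩ := Set.mem_smul_set.1 hz
    refine ⟨(2 : ℝ) ^ (-((n : ℝ) + θ)), ⟨?_, ?_⟩, geomChain_rpow hj n hθ⟩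
    · exact Real.rpow_le_rpow_of_exponent_le one_le_two (by linarith [hθ.2])
    · exact Real.rpow_le_rpow_of_exponent_le one_le_two (by linarith [hθ.1])

/-- The image of `[2⁻⁽ⁿ⁺¹⁾, 2⁻ⁿ]`, `n : ℕ`, with inverse powers. [folklore] -/
theorem image_geomChain_Icc_nat (hj : G 0 = (2 : ℝ) • G 1) (n : ℕ) :
    geomChain G '' Icc (((2 : ℝ) ^ (n + 1))⁻¹) (((2 : ℝ) ^ n)⁻¹) =
      ((2 : ℝ) ^ n)⁻¹ • (G '' Icc 0 1) := by
  have key := image_geomChain_Icc hj n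
  have e1 : (2 : ℝ) ^ (-((n : ℝ) + 1)) = ((2 : ℝ) ^ (n + 1))⁻¹ := by
    rw [Real.rpow_neg two_pos.le, show ((n : ℝ) + 1) = ((n + 1 : ℕ) : ℝ) by push_cast; ring,
      Real.rpow_natCast]
  have e2 : (2 : ℝ) ^ (-(n : ℝ)) = ((2 : ℝ) ^ n)⁻¹ := by
    rw [Real.rpow_neg two_pos.le, Real.rpow_natCast]
  rw [Int.cast_natCast, e1, e2] at key
  exact key

/-- The parameters `2^{-(n+θ)}`, `θ ∈ [0, 1]`, `n : ℕ`, lie in `[2⁻⁽ⁿ⁺¹⁾, 2⁻ⁿ] ⊆ (0, 1]`.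
[folklore] -/
theorem rpow_neg_mem_Icc (n : ℕ) {θ : ℝ} (hθ : θ ∈ Icc (0 : ℝ) 1) :
    (2 : ℝ) ^ (-((n : ℝ) + θ)) ∈ Icc (((2 : ℝ) ^ (n + 1))⁻¹) (((2 : ℝ) ^ n)⁻¹) := by
  constructor
  · rw [← Real.rpow_natCast, ← Real.rpow_neg two_pos.le]
    exact Real.rpow_le_rpow_of_exponent_le one_le_two (by push_cast; linarith [hθ.2])
  · rw [← Real.rpow_natCast, ← Real.rpow_neg two_pos.le]
    exact Real.rpow_le_rpow_of_exponent_le one_le_two (by linarith [hθ.1])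

/-- **Continuity of the chain**, for a continuous piece with matching ends `G 0 = 2 • G 1`.
[folklore] -/
theorem continuous_geomChain (hG : Continuous G) (hj : G 0 = (2 : ℝ) • G 1) :
    Continuous (geomChain G) := by
  -- the `1`-periodic continuous function `φ ∘ fract`, `φ θ = 2^θ • G θ`
  obtain ⟨φ, hφ⟩ : ∃ φ : ℝ → ℂ, φ = fun θ => ((2 : ℝ) ^ θ) • G θ := ⟨_, rfl⟩
  have hφc : Continuous φ := by
    rw [hφ]
    exact (continuous_iff_continuousAt.2 fun θ => Real.continuousAt_const_rpow two_ne_zero).smul hG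
  have hφ01 : φ 0 = φ 1 := by simp [hφ, hj]
  have hψ : Continuous (φ ∘ Int.fract) := hφc.continuousOn.comp_fract'' hφ01
  have heq : geomChain G = fun t => t • (φ ∘ Int.fract) (-Real.logb 2 t) := by
    funext t
    simp only [geomChain, chainPhase, hφ, comp_apply, smul_smul]
  rw [heq]
  obtain ⟨M, hM⟩ : ∃ M, ∀ θ ∈ Icc (0 : ℝ) 1, ‖φ θ‖ ≤ M :=
    isCompact_Icc.exists_bound_of_continuousOn hφc.continuousOn
  refine continuous_iff_continuousAt.2 fun t => ?_
  rcases eq_or_ne t 0 with rfl | ht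
  · -- at the accumulation point: `‖t • ψ‖ ≤ M ‖t‖ → 0`
    have hb : ∀ s : ℝ, ‖s • (φ ∘ Int.fract) (-Real.logb 2 s)‖ ≤ M * ‖s‖ := fun s => by
      rw [norm_smul, mul_comm]
      exact mul_le_mul_of_nonneg_right
        (hM _ ⟨Int.fract_nonneg _, (Int.fract_lt_one _).le⟩) (norm_nonneg _)
    have hc : Continuous fun s : ℝ => M * ‖s‖ := continuous_const.mul continuous_norm
    have h0 : Tendsto (fun s : ℝ => M * ‖s‖) (𝓝 0) (𝓝 0) := by
      simpa using hc.tendsto 0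
    have := squeeze_zero_norm hb h0
    simpa [ContinuousAt] using this
  · exact continuousAt_id.smul
      (hψ.continuousAt.comp (ContinuousAt.neg (Real.continuousAt_logb ht)))

/-- Real parts along the chain: at `t > 0` the value `2⁻ᵐ • G θ` (`m = ⌊-log₂ t⌋`) has real
part in `(2⁻ᵐ R / 2, 2⁻ᵐ R]` when the piece has real parts in `(R / 2, R]`, `R = re G 0`.
[folklore] -/
theorem re_geomChain_mem {t : ℝ} (ht : 0 < t)
    (hre : ∀ θ ∈ Ico (0 : ℝ) 1, (G 0).re < 2 * (G θ).re ∧ (G θ).re ≤ (G 0).re) :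
    (2 : ℝ) ^ (-(⌊-Real.logb 2 t⌋ : ℝ)) * (G 0).re < 2 * (geomChain G t).re ∧
      (geomChain G t).re ≤ (2 : ℝ) ^ (-(⌊-Real.logb 2 t⌋ : ℝ)) * (G 0).re := by
  rw [geomChain_of_pos ht, Complex.smul_re, smul_eq_mul]
  have hc : 0 < (2 : ℝ) ^ (-(⌊-Real.logb 2 t⌋ : ℝ)) := Real.rpow_pos_of_pos two_pos _
  obtain ⟨h1, h2⟩ := hre _ ⟨Int.fract_nonneg _, Int.fract_lt_one _⟩
  constructor <;> nlinarith

/-- **Injectivity of the chain on `[0, ∞)`**: the piece is injective on `[0, 1)`, with real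
parts in the half-open strip `(re G 0 / 2, re G 0]`, `0 < re G 0`. [folklore] -/
theorem injOn_geomChain (hinj : InjOn G (Ico 0 1)) (h0 : 0 < (G 0).re)
    (hre : ∀ θ ∈ Ico (0 : ℝ) 1, (G 0).re < 2 * (G θ).re ∧ (G θ).re ≤ (G 0).re) :
    InjOn (geomChain G) (Ici 0) := by
  -- positive parameters have values with positive real part
  have hpos : ∀ {t : ℝ}, 0 < t → 0 < (geomChain G t).re := fun {t} ht => by
    have h := (re_geomChain_mem ht hre).1
    have hc : 0 < (2 : ℝ) ^ (-(⌊-Real.logb 2 t⌋ : ℝ)) := Real.rpow_pos_of_pos two_pos _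
    nlinarith
  -- the level `⌊-log₂ t⌋` is determined by the value
  have hlevel : ∀ {s t : ℝ}, 0 < s → 0 < t → geomChain G s = geomChain G t →
      ⌊-Real.logb 2 s⌋ ≤ ⌊-Real.logb 2 t⌋ := by
    intro s t hs ht hst
    by_contra hlt
    push Not at hlt
    have hle : (⌊-Real.logb 2 t⌋ : ℝ) + 1 ≤ ⌊-Real.logb 2 s⌋ := by
      exact_mod_cast Int.add_one_le_iff.2 hlt
    obtain ⟨-, hs2⟩ := re_geomChain_mem hs hre
    obtain ⟨ht1, -⟩ := re_geomChain_mem ht hre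
    rw [hst] at hs2
    -- `2^{-m_s} R ≤ 2^{-m_t} R / 2`
    have hpow : (2 : ℝ) ^ (-(⌊-Real.logb 2 s⌋ : ℝ)) * 2 ≤ (2 : ℝ) ^ (-(⌊-Real.logb 2 t⌋ : ℝ)) := by
      have e : (2 : ℝ) ^ (-(⌊-Real.logb 2 s⌋ : ℝ)) * 2 = (2 : ℝ) ^ (-(⌊-Real.logb 2 s⌋ : ℝ) + 1) := by
        rw [Real.rpow_add two_pos, Real.rpow_one]
      rw [e]
      exact Real.rpow_le_rpow_of_exponent_le one_le_two (by linarith)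
    nlinarith [Real.rpow_pos_of_pos two_pos (-(⌊-Real.logb 2 s⌋ : ℝ)),
      mul_le_mul_of_nonneg_right hpow h0.le]
  intro s hs t ht hst
  rcases (eq_or_lt_of_le (show (0 : ℝ) ≤ s from hs)) with hs0 | hs0 <;>
    rcases (eq_or_lt_of_le (show (0 : ℝ) ≤ t from ht)) with ht0 | ht0
  · rw [← hs0, ← ht0]
  · exfalso
    have h := hpos ht0
    rw [← hst, ← hs0, geomChain_zero, Complex.zero_re] at h
    exact lt_irrefl _ h
  · exfalso
    have h := hpos hs0
    rw [hst, ← ht0, geomChain_zero, Complex.zero_re] at h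
    exact lt_irrefl _ h
  · -- both positive: same level, then same phase, then same parameter
    have hm : ⌊-Real.logb 2 s⌋ = ⌊-Real.logb 2 t⌋ :=
      le_antisymm (hlevel hs0 ht0 hst) (hlevel ht0 hs0 hst.symm)
    have hval := hst
    rw [geomChain_of_pos hs0, geomChain_of_pos ht0, hm] at hval
    have hG : G (Int.fract (-Real.logb 2 s)) = G (Int.fract (-Real.logb 2 t)) :=
      smul_right_injective ℂ (Real.rpow_pos_of_pos two_pos _).ne' hval
    have hθ : Int.fract (-Real.logb 2 s) = Int.fract (-Real.logb 2 t) :=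
      hinj ⟨Int.fract_nonneg _, Int.fract_lt_one _⟩ ⟨Int.fract_nonneg _, Int.fract_lt_one _⟩ hG
    have hu : -Real.logb 2 s = -Real.logb 2 t := by
      rw [← Int.floor_add_fract (-Real.logb 2 s), ← Int.floor_add_fract (-Real.logb 2 t), hm, hθ]
    have := Real.logb_injOn_pos one_lt_two hs0 ht0 (neg_injective hu)
    exact this

/-- Injectivity on `[0, 1]` (the form consumed by `quadLoop`). [folklore] -/
theorem injOn_geomChain_Icc (hinj : InjOn G (Ico 0 1)) (h0 : 0 < (G 0).re)
    (hre : ∀ θ ∈ Ico (0 : ℝ) 1, (G 0).re < 2 * (G θ).re ∧ (G θ).re ≤ (G 0).re) :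
    InjOn (geomChain G) (Icc 0 1) :=
  (injOn_geomChain hinj h0 hre).mono fun _ ht => ht.1

/-- Positive parameters give values with positive real part (under the strip hypothesis).
[folklore] -/
theorem re_geomChain_pos {t : ℝ} (ht : 0 < t)
    (hre : ∀ θ ∈ Ico (0 : ℝ) 1, (G 0).re < 2 * (G θ).re ∧ (G θ).re ≤ (G 0).re) :
    0 < (geomChain G t).re := by
  have h := (re_geomChain_mem ht hre).1
  have h0 : 0 ≤ (G 0).re := by
    have := hre 0 ⟨le_rfl, one_pos⟩
    linarith
  have hc : 0 < (2 : ℝ) ^ (-(⌊-Real.logb 2 t⌋ : ℝ)) := Real.rpow_pos_of_pos two_pos _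
  nlinarith

end Literature.Topology.PlaneTopology
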